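import Summits.CriticalPhenomena.PercolationContinuityZ3.Theorems.PercNearOneGluingNoHeavyQuantIndepBlobGradedMerge
import Summits.CriticalPhenomena.PercolationContinuityZ3.Theorems.PercNearOneGluingNoHeavyQuantIndepBlobOneLightCantelliAlg
import Summits.CriticalPhenomena.PercolationContinuityZ3.Theorems.PercNearOneGluingNoHeavyQuantIndepBlobOddSizeRow
import Summits.CriticalPhenomena.PercolationContinuityZ3.Theorems.PercNearOneGluingNoHeavyQuantIndepBlobDiscountLow
import Summits.CriticalPhenomena.PercolationContinuityZ3.Theorems.PercNearOneGluingNoHeavyQuantIndepBlobLowFloor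
import HarnessLib

/-!
# QUANT lane R8, Conjecture DIB\* with ONE light blob holds at EVERY floor — merge, or Cantelli, and nothing else

builds on p205010 (kernel theorem, internal audit signed; external expert review pending)

Support file (`--supports stmt-CriticalPhenomena-4575`), QUANT lane seat prim-quant-p1 (gen 11); memo
`run/shared/lean/prim/quant/P1-SURPLUS.md` §22.  Theorems only; no definitions, no sorries, standard axioms.  One-type vocabulary of
`…QuantIndepBlobGateRaise` / `…QuantIndepBlobOddSizeRow`: blobs `κ`, gates `p`, integer sizes `a`, ONE distinguished blob `x₀` (the light one),
configurations `s : Finset κ` with product weight `∏ (p k if k ∈ s else 1 − p k)`.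

**Conjecture DIB\*** (census-2 g49; typed `Quant.IndepBlob.DIBStar`, README V185) with exactly one blob below the floor: floor `x`, heavy blobs
`k ≠ x₀` with `p k ≥ x`, the light blob `x₀` with `x² ≤ p x₀ ≤ x` and `a x₀ ≤ j`, credit `Σ_{k ≠ x₀} a k·p k + a x₀·(p x₀ − x²)/(1 − x) > 2j`
⟹ `P(N ≥ j+1) ≥ x`.  Kernel before this file: `x ≤ 1/2` (lead g15 `IndepBlob.dibStar_of_le_half`), heavy total `≥ 2j+1` (lead g15
`IndepBlob.sizeRow_with_extra_blob`), `x³ + x ≥ 1` (census-1 g14 `IndepBlob.tail_ge_of_oneLight`, other vocabulary).  THIS FILE: every floor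
`0 < x < 1` (`tail_ge_of_oneLight_allFloors`).  The new cell is `1/2 ≤ x`, heavy total `≤ 2j`:

* a heavy giant (`a k ≥ j+1`) decides alone (`tail_ge_gate_of_giant`);
* if `p x₀ · A_H ≥ j` the light blob MERGES upward (p1 g11 `IndepBlob.tail_ge_of_gradedMerge`, full credit);
* otherwise CANTELLI with the crude variance bound `V ≤ j·Σ_{k≠x₀} a k(1 − p k) + (a x₀)² g(1−g)` (`IndepBlob.count_cantelli`) — the algebra
  `¬merge ∧ credit ∧ A_H ≤ 2j ⟹ x·V ≤ (1−x)(m − j)²` is `IndepBlob.OneLightAlg.main` (`…QuantIndepBlobOneLightCantelliAlg`), relative slack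
  `≥ 0.2` everywhere and `x(1−x)` as `x → 1` (memo §22.3; 0 / 4 991 actual instances; census-1 g14's "middle third needs Cantelli").

* `IndepBlob.tail_ge_gate_of_giant`, `IndepBlob.tail_ge_of_oneLight_cantelli` (the cell), `IndepBlob.tail_ge_of_oneLight_half_le_corner`
  (`1/2 ≤ x`, `A_H ≤ 2j`), `IndepBlob.tail_ge_of_oneLight_half_le` (`1/2 ≤ x`), **`IndepBlob.tail_ge_of_oneLight_allFloors`** (`0 < x < 1`).
[cite: KozmaNitzan2024, Conjecture 3 (p. 15)] (the gluing rows served); the rows are [this work].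
-/

namespace Summit.CriticalPhenomena.PercolationContinuityZ3.Theorems

namespace Quant

namespace IndepBlob

open Finset

variable {κ : Type*} [Fintype κ] [DecidableEq κ]

/-- **A giant decides alone**: if `j + 1 ≤ a k` then `p k ≤ P(N ≥ j+1)` (gates in `[0,1]`). [folklore] -/
theorem tail_ge_gate_of_giant (p : κ → ℝ) (a : κ → ℕ) (hp0 : ∀ k, 0 ≤ p k) (hp1 : ∀ k, p k ≤ 1) (j : ℕ) (k : κ)
    (hk : j + 1 ≤ a k) :
    p k ≤ ∑ s ∈ (Finset.univ : Finset (Finset κ)).filter (fun s => j + 1 ≤ ∑ i ∈ s, a i),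
      (∏ i, if i ∈ s then p i else 1 - p i) := by
  rw [← sum_bernoulliWeight_mul_indicator p k, Finset.sum_filter]
  refine Finset.sum_le_sum fun W _ => ?_
  have hw := bernoulliWeight_nonneg hp0 hp1 W
  by_cases hkW : k ∈ W
  · rw [if_pos hkW, if_pos (hk.trans (Finset.single_le_sum (fun i _ => Nat.zero_le (a i)) hkW)), mul_one]
  · rw [if_neg hkW, mul_zero]
    split_ifs
    · exact hw
    · exact le_refl _

/-- the tail as a complement: `P(N ≥ j+1) = 1 − P(N ≤ j)` (real-valued count form, for `count_cantelli` / `dibStar_of_le_half`) -/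
theorem tail_eq_one_sub_real (p : κ → ℝ) (a : κ → ℕ) (j : ℕ) :
    ∑ s ∈ (Finset.univ : Finset (Finset κ)).filter (fun s => j + 1 ≤ ∑ i ∈ s, a i), (∏ i, if i ∈ s then p i else 1 - p i) =
      1 - ∑ W ∈ (Finset.univ : Finset (Finset κ)).filter (fun W => ∑ i ∈ W, (a i : ℝ) ≤ (j : ℝ)),
        (∏ i, if i ∈ W then p i else 1 - p i) := by
  have hf : (Finset.univ : Finset (Finset κ)).filter (fun W => ∑ i ∈ W, (a i : ℝ) ≤ (j : ℝ)) =
      (Finset.univ : Finset (Finset κ)).filter (fun s => ¬ (j + 1 ≤ ∑ i ∈ s, a i)) := by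
    ext W
    simp only [Finset.mem_filter, Finset.mem_univ, true_and, not_le, Nat.lt_succ_iff]
    rw [← Nat.cast_sum, Nat.cast_le]
  rw [hf, eq_sub_iff_add_eq, Finset.sum_filter_add_sum_filter_not, sum_bernoulliWeight]

/-- **The Cantelli cell.**  Floor `1/2 ≤ x < 1`; heavy blobs `k ≠ x₀` with `x ≤ p k ≤ 1` and `a k ≤ j`; the light blob `x₀` with
`x² ≤ p x₀ ≤ x`, `a x₀ ≤ j`; heavy total `A_H ≤ 2j`; NOT mergeable (`p x₀ · A_H < j`); DIB\* credit
`2j < Σ_{k≠x₀} a k p k + a x₀ (p x₀ − x²)/(1−x)`.  Then `x ≤ P(N ≥ j+1)`. [this work] -/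
theorem tail_ge_of_oneLight_cantelli (p : κ → ℝ) (a : κ → ℕ) (x₀ : κ) (x : ℝ) (j : ℕ)
    (hp0 : ∀ k, 0 ≤ p k) (hp1 : ∀ k, p k ≤ 1) (hx : 1 / 2 ≤ x) (hx1 : x < 1)
    (hgl : x ^ 2 ≤ p x₀) (hgu : p x₀ ≤ x) (hsize : ∀ k, k ≠ x₀ → a k ≤ j) (hbj : a x₀ ≤ j)
    (hA : (∑ k ∈ Finset.univ.erase x₀, a k) ≤ 2 * j)
    (hG : p x₀ * (∑ k ∈ Finset.univ.erase x₀, (a k : ℝ)) < j)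
    (hcredit : (2 * j : ℝ) < (∑ k ∈ Finset.univ.erase x₀, (a k : ℝ) * p k) + a x₀ * ((p x₀ - x ^ 2) / (1 - x))) :
    x ≤ ∑ s ∈ (Finset.univ : Finset (Finset κ)).filter (fun s => j + 1 ≤ ∑ i ∈ s, a i),
      (∏ i, if i ∈ s then p i else 1 - p i) := by
  set A : ℝ := ∑ k ∈ Finset.univ.erase x₀, (a k : ℝ) with hAdef
  set B : ℝ := ∑ k ∈ Finset.univ.erase x₀, (a k : ℝ) * p k with hBdef
  set b : ℝ := (a x₀ : ℝ) with hbdef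
  set g : ℝ := p x₀ with hgdef
  have hy : 0 < 1 - x := by linarith
  have hb0 : 0 ≤ b := Nat.cast_nonneg _
  have hbj' : b ≤ j := by rw [hbdef]; exact_mod_cast hbj
  have hA2 : A ≤ 2 * j := by rw [hAdef, ← Nat.cast_sum]; exact_mod_cast hA
  have hcredit' : 2 * j * (1 - x) < (1 - x) * B + b * (g - x ^ 2) := by
    have hk : (g - x ^ 2) / (1 - x) * (1 - x) = g - x ^ 2 := div_mul_cancel₀ _ hy.ne'
    have := mul_lt_mul_of_pos_right hcredit hy
    have e : (B + b * ((g - x ^ 2) / (1 - x))) * (1 - x) = (1 - x) * B + b * ((g - x ^ 2) / (1 - x) * (1 - x)) := by ring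
    rw [e, hk] at this
    linarith
  -- the algebraic cell
  have halg := OneLightAlg.main x g b j A B hx hx1 hgl hgu hb0 hbj' hA2 hG hcredit'
  -- mean and variance of the count, split at `x₀`
  have hmean : ∑ k, (a k : ℝ) * p k = B + b * g := by
    rw [← Finset.add_sum_erase Finset.univ _ (Finset.mem_univ x₀), hBdef, hbdef, hgdef, add_comm]
  have hvar : ∑ k, (a k : ℝ) ^ 2 * p k * (1 - p k) ≤ j * (A - B) + b ^ 2 * g * (1 - g) := by
    rw [← Finset.add_sum_erase Finset.univ _ (Finset.mem_univ x₀), hAdef, hBdef, ← Finset.sum_sub_distrib, Finset.mul_sum]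
    have hH : ∑ k ∈ Finset.univ.erase x₀, (a k : ℝ) ^ 2 * p k * (1 - p k) ≤
        ∑ k ∈ Finset.univ.erase x₀, (j : ℝ) * ((a k : ℝ) - (a k : ℝ) * p k) := by
      refine Finset.sum_le_sum fun k hk => ?_
      have hkj : (a k : ℝ) ≤ j := by exact_mod_cast hsize k (Finset.ne_of_mem_erase hk)
      have ha0 : (0 : ℝ) ≤ a k := Nat.cast_nonneg _
      have h1 : (a k : ℝ) * p k ≤ j := by nlinarith [hp1 k, hp0 k]
      have h2 : 0 ≤ (a k : ℝ) * (1 - p k) := mul_nonneg ha0 (by linarith [hp1 k])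
      nlinarith [mul_le_mul_of_nonneg_right h1 h2, hp0 k]
    have e : (a x₀ : ℝ) ^ 2 * p x₀ * (1 - p x₀) = b ^ 2 * g * (1 - g) := by rw [hbdef, hgdef]
    linarith
  -- `m > j`
  have hκ : (g - x ^ 2) / (1 - x) ≤ x := by rw [div_le_iff₀ hy]; nlinarith
  have hmj : (j : ℝ) < ∑ k, (a k : ℝ) * p k := by
    rw [hmean]
    have h1 : b * ((g - x ^ 2) / (1 - x)) ≤ b * x := mul_le_mul_of_nonneg_left hκ hb0
    have h2 : 0 ≤ b * g := mul_nonneg hb0 (hp0 x₀)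
    have hj0 : (0 : ℝ) ≤ j := Nat.cast_nonneg _
    nlinarith
  -- Cantelli
  have hcant := count_cantelli p (fun k => (a k : ℝ)) hp0 hp1 (j : ℝ) hmj
  rw [hmean] at hcant
  have hV0 : 0 ≤ ∑ k, (a k : ℝ) ^ 2 * p k * (1 - p k) := Finset.sum_nonneg fun k _ =>
    mul_nonneg (mul_nonneg (sq_nonneg _) (hp0 k)) (by linarith [hp1 k])
  have hs2 : 0 < (B + b * g - j) ^ 2 := by
    have : 0 < B + b * g - j := by rw [hmean] at hmj; linarith
    positivity
  have hbound : (∑ k, (a k : ℝ) ^ 2 * p k * (1 - p k)) /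
      ((∑ k, (a k : ℝ) ^ 2 * p k * (1 - p k)) + (B + b * g - j) ^ 2) ≤ 1 - x := by
    rw [div_le_iff₀ (by linarith)]
    have h1 : x * (∑ k, (a k : ℝ) ^ 2 * p k * (1 - p k)) ≤ x * (j * (A - B) + b ^ 2 * g * (1 - g)) :=
      mul_le_mul_of_nonneg_left hvar (by linarith)
    have e : (1 - x) * ((∑ k, (a k : ℝ) ^ 2 * p k * (1 - p k)) + (B + b * g - j) ^ 2) =
        (∑ k, (a k : ℝ) ^ 2 * p k * (1 - p k)) - x * (∑ k, (a k : ℝ) ^ 2 * p k * (1 - p k)) +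
          (1 - x) * (B + b * g - j) ^ 2 := by ring
    rw [e]
    linarith
  rw [tail_eq_one_sub_real]
  linarith [hcant.trans hbound]

/-- **One light blob, floor `≥ 1/2`, heavy total `≤ 2j`.**  Floor `1/2 ≤ x < 1`; gates in `[0,1]`; heavy blobs `k ≠ x₀` with `x ≤ p k`;
the light blob with `x² ≤ p x₀ ≤ x` and `a x₀ ≤ j`; `Σ_{k≠x₀} a k ≤ 2j`; DIB\* credit.  Then `x ≤ P(N ≥ j+1)`: a heavy giant decides, else the
light blob merges (`tail_ge_of_gradedMerge`), else Cantelli (`tail_ge_of_oneLight_cantelli`). [this work] -/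
theorem tail_ge_of_oneLight_half_le_corner (p : κ → ℝ) (a : κ → ℕ) (x₀ : κ) (x : ℝ) (j : ℕ)
    (hp0 : ∀ k, 0 ≤ p k) (hp1 : ∀ k, p k ≤ 1) (hx : 1 / 2 ≤ x) (hx1 : x < 1)
    (hheavy : ∀ k, k ≠ x₀ → x ≤ p k) (hgl : x ^ 2 ≤ p x₀) (hgu : p x₀ ≤ x) (hbj : a x₀ ≤ j)
    (hA : (∑ k ∈ Finset.univ.erase x₀, a k) ≤ 2 * j)
    (hcredit : (2 * j : ℝ) < (∑ k ∈ Finset.univ.erase x₀, (a k : ℝ) * p k) + a x₀ * ((p x₀ - x ^ 2) / (1 - x))) :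
    x ≤ ∑ s ∈ (Finset.univ : Finset (Finset κ)).filter (fun s => j + 1 ≤ ∑ i ∈ s, a i),
      (∏ i, if i ∈ s then p i else 1 - p i) := by
  have hy : 0 < 1 - x := by linarith
  -- a heavy giant decides
  by_cases hgiant : ∃ k, k ≠ x₀ ∧ j + 1 ≤ a k
  · obtain ⟨k, hk, hjk⟩ := hgiant
    exact (hheavy k hk).trans (tail_ge_gate_of_giant p a hp0 hp1 j k hjk)
  push Not at hgiant
  have hsize : ∀ k, k ≠ x₀ → a k ≤ j := fun k hk => Nat.lt_succ_iff.1 (hgiant k hk)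
  -- the true mean dominates the credit (`κ(g) ≤ g` for `g ≤ x`)
  have hκg : (p x₀ - x ^ 2) / (1 - x) ≤ p x₀ := by rw [div_le_iff₀ hy]; nlinarith [hp0 x₀]
  have hmean : (2 * j : ℝ) < ∑ k, (a k : ℝ) * p k := by
    rw [← Finset.add_sum_erase Finset.univ _ (Finset.mem_univ x₀)]
    have := mul_le_mul_of_nonneg_left hκg (Nat.cast_nonneg (a x₀))
    linarith
  -- some heavy blob has positive size (the heavy credit is positive)
  have hκx : (p x₀ - x ^ 2) / (1 - x) ≤ x := by rw [div_le_iff₀ hy]; nlinarith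
  have hBpos : 0 < ∑ k ∈ Finset.univ.erase x₀, (a k : ℝ) * p k := by
    have h1 : (a x₀ : ℝ) * ((p x₀ - x ^ 2) / (1 - x)) ≤ j * x := by
      have hb : (a x₀ : ℝ) ≤ j := by exact_mod_cast hbj
      have := mul_le_mul_of_nonneg_left hκx (Nat.cast_nonneg (a x₀))
      nlinarith
    have hj0 : (0 : ℝ) ≤ j := Nat.cast_nonneg _
    nlinarith
  have hH : ∃ i, i ≠ x₀ ∧ 0 < a i := by
    by_contra hcon
    push Not at hcon
    have : ∑ k ∈ Finset.univ.erase x₀, (a k : ℝ) * p k = 0 := by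
      refine Finset.sum_eq_zero fun k hk => ?_
      rw [Nat.le_zero.1 (hcon k (Finset.ne_of_mem_erase hk)), Nat.cast_zero, zero_mul]
    linarith
  by_cases hlight : p x₀ < x
  swap
  · -- the distinguished blob is at the floor: every gate is `≥ x`
    have hall : ∀ k, x ≤ p k := by
      intro k
      by_cases hk : k = x₀
      · rw [hk]; exact not_lt.1 hlight
      · exact hheavy k hk
    exact tail_ge_floor_of_heavy p a x j hp0 hp1 hx1.le hall hmean
  by_cases hM : (j : ℝ) ≤ p x₀ * ∑ k ∈ Finset.univ.erase x₀, (a k : ℝ)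
  · -- MERGE
    refine tail_ge_of_gradedMerge p a x j hp0 hp1 hx1.le (fun k hk => ?_) (fun k hk => ?_) hmean
    · have hkx : k = x₀ := by
        by_contra h
        exact absurd (hheavy k h) (not_le.2 hk)
      subst hkx
      refine hM.trans (mul_le_mul_of_nonneg_left ?_ (hp0 k))
      refine Finset.sum_le_sum_of_subset_of_nonneg (fun i hi => ?_) fun i _ _ => Nat.cast_nonneg _
      rw [Finset.mem_filter]
      exact ⟨Finset.mem_univ _, lt_of_lt_of_le hk (hheavy i (Finset.ne_of_mem_erase hi))⟩
    · have hkx : k = x₀ := by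
        by_contra h
        exact absurd (hheavy k h) (not_le.2 hk)
      subst hkx
      obtain ⟨i, hi, hai⟩ := hH
      exact ⟨i, lt_of_lt_of_le hk (hheavy i hi), hai⟩
  · -- CANTELLI
    push Not at hM
    exact tail_ge_of_oneLight_cantelli p a x₀ x j hp0 hp1 hx hx1 hgl hgu hsize hbj hA hM hcredit

/-- **One light blob, every floor `≥ 1/2`.**  As `tail_ge_of_oneLight_half_le_corner` without the restriction on the heavy total: when
`Σ_{k≠x₀} a k ≥ 2j+1` the size row with one extra blob (lead g15 `sizeRow_with_extra_blob`) applies. [this work] -/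
theorem tail_ge_of_oneLight_half_le (p : κ → ℝ) (a : κ → ℕ) (x₀ : κ) (x : ℝ) (j : ℕ)
    (hp0 : ∀ k, 0 ≤ p k) (hp1 : ∀ k, p k ≤ 1) (hx : 1 / 2 ≤ x) (hx1 : x < 1)
    (hheavy : ∀ k, k ≠ x₀ → x ≤ p k) (hgl : x ^ 2 ≤ p x₀) (hgu : p x₀ ≤ x) (hbj : a x₀ ≤ j)
    (hcredit : (2 * j : ℝ) < (∑ k ∈ Finset.univ.erase x₀, (a k : ℝ) * p k) + a x₀ * ((p x₀ - x ^ 2) / (1 - x))) :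
    x ≤ ∑ s ∈ (Finset.univ : Finset (Finset κ)).filter (fun s => j + 1 ≤ ∑ i ∈ s, a i),
      (∏ i, if i ∈ s then p i else 1 - p i) := by
  by_cases hA : (∑ k ∈ Finset.univ.erase x₀, a k) ≤ 2 * j
  · exact tail_ge_of_oneLight_half_le_corner p a x₀ x j hp0 hp1 hx hx1 hheavy hgl hgu hbj hA hcredit
  push Not at hA
  -- heavy total ≥ 2j+1: a heavy blob exists; take the least heavy gate
  have hne : (Finset.univ.erase x₀ : Finset κ).Nonempty := by
    by_contra h
    rw [Finset.not_nonempty_iff_eq_empty] at h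
    rw [h, Finset.sum_empty] at hA
    omega
  obtain ⟨y₀, hy₀, hmin⟩ := Finset.exists_min_image (Finset.univ.erase x₀) p hne
  have hy₀ne : y₀ ≠ x₀ := Finset.ne_of_mem_erase hy₀
  have hsize : 2 * j + 1 + a x₀ ≤ ∑ k, a k := by
    rw [← Finset.add_sum_erase Finset.univ _ (Finset.mem_univ x₀)]
    omega
  have key := sizeRow_with_extra_blob p a hp0 hp1 x₀ y₀ hy₀ne
    (fun k hk => hmin k (Finset.mem_erase.2 ⟨hk, Finset.mem_univ _⟩)) (hx.trans (hheavy y₀ hy₀ne)) j hsize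
  exact (hheavy y₀ hy₀ne).trans key

/-- **DIB\* WITH ONE LIGHT BLOB, EVERY FLOOR.**  Floor `0 < x < 1`; gates in `[0,1]`; every blob `k ≠ x₀` has `x ≤ p k`; the blob `x₀`
has `x² ≤ p x₀ ≤ x` and `a x₀ ≤ j`; and `2j < Σ_{k≠x₀} a k·p k + a x₀·(p x₀ − x²)/(1−x)` (heavy blobs at their mean, the light one at the
discount `κ_x`).  Then `x ≤ P(N ≥ j+1)`.  Floors `≤ 1/2`: lead g15's `dibStar_of_le_half` (Cantelli with the discount paying the variance);
floors `≥ 1/2`: `tail_ge_of_oneLight_half_le`. [this work] -/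
theorem tail_ge_of_oneLight_allFloors (p : κ → ℝ) (a : κ → ℕ) (x₀ : κ) (x : ℝ) (j : ℕ)
    (hp0 : ∀ k, 0 ≤ p k) (hp1 : ∀ k, p k ≤ 1) (hx0 : 0 < x) (hx1 : x < 1)
    (hheavy : ∀ k, k ≠ x₀ → x ≤ p k) (hgl : x ^ 2 ≤ p x₀) (hgu : p x₀ ≤ x) (hbj : a x₀ ≤ j)
    (hcredit : (2 * j : ℝ) < (∑ k ∈ Finset.univ.erase x₀, (a k : ℝ) * p k) + a x₀ * ((p x₀ - x ^ 2) / (1 - x))) :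
    x ≤ ∑ s ∈ (Finset.univ : Finset (Finset κ)).filter (fun s => j + 1 ≤ ∑ i ∈ s, a i),
      (∏ i, if i ∈ s then p i else 1 - p i) := by
  by_cases hx : 1 / 2 ≤ x
  · exact tail_ge_of_oneLight_half_le p a x₀ x j hp0 hp1 hx hx1 hheavy hgl hgu hbj hcredit
  push Not at hx
  -- floor below 1/2: lead g15's discounted Cantelli row with heavy set `univ.erase x₀`
  have hcompl : (Finset.univ.erase x₀ : Finset κ)ᶜ = {x₀} := by
    ext k
    simp
  have key := dibStar_of_le_half p (fun k => (a k : ℝ)) x hx0.le hx.le hp0 hp1 (fun k => Nat.cast_nonneg (a k))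
    (Finset.univ.erase x₀) (fun i hi => hheavy i (Finset.ne_of_mem_erase hi))
    (fun i hi => by
      have : i = x₀ := by
        by_contra h
        exact hi (Finset.mem_erase.2 ⟨h, Finset.mem_univ _⟩)
      rw [this]; exact hgu)
    (j : ℝ) (by rw [hcompl, Finset.sum_singleton]; exact hcredit)
    (fun i hi => by
      have : i = x₀ := by
        by_contra h
        exact hi (Finset.mem_erase.2 ⟨h, Finset.mem_univ _⟩)
      rw [this]; exact_mod_cast hbj)
  rw [tail_eq_one_sub_real]
  linarith

end IndepBlob

end Quant

end Summit.CriticalPhenomena.PercolationContinuityZ3.Theorems
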